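import Summits.RiemannHypothesis.RiemannHypothesis.Theorems.MotivicDoorAWSEnergyBounds

/-!
# AWS sprint, TEST-CLASS-DOWN (3/3): the QUANTITATIVE `C¹`-window modulus of `Re Q`, `𝔰`, `d⋆`, `d_u` (Markov-form route)

HONEST LABEL.  One-way implication from a strengthened, prime-side-only axiom system; the existence
of an `ArithmeticWeilSurface` is NOT claimed and is the located gap.  SATISFIABILITY OF THE AXIOM LIST
IS EQUIVALENT TO RH (kernel form for Gram-data carriers: `riemannHypothesis_iff_exists_tautologicalCarrier`,
`Theorems/MotivicDoor/AWS/Tautological.lean`; for this structure: the free lattice on the tautological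
generating family, DERIVED in `AWS-DESIGN.md` §8) — forward direction by forcing; the structure is a
REFORMULATION isolating the sign condition `hodge` (which, with the three prime-side identities, already
says "Weil positivity on the real span of the generating family"), not a weaker or different hypothesis.
(This supersedes the earlier clause "the converse is not expected to be provable".)  Framing: lottery
ticket at the motivic door; RH probability negligible; consolation prizes are real: a new semi-local
Weil-positivity theorem, or a located gap in the Connes–Consani programme, plus the ff-door theorem.

Via the tree's Markov form
`Re Q(g) = P(g) + 𝓔_R(g) − M_R ‖g‖₂²` (`weilQuadratic_re_eq_weilPoleForm_add_weilDirichletEnergy_sub`)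
this file gives EXPLICIT Lipschitz-type moduli, in the `C¹`-window topology, for `Re Q(u)`
(`abs_re_weilQuadratic_sub_le_eps`: `|Re Q(u) − Re Q(v)| ≤ ε · K_Q(R, S, S')` with `K_Q` spelled out from
`cosh(R/2)`, the prime sum `Σ_{n ≤ e^R} Λ(n)/√n`, `∫₁^∞ w_arch` and the Markov constant `M_R`) and for
`𝔰(f_u,f_u)` (`abs_ccPairing_sub_le_of_bounds`, through `two_mul_ccPairing_sub_two_mul_masses_eq`), and the
resulting explicit Lipschitz form `ccData_lipschitz` (constant `ccPairingModulus R S S'`) with the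
tolerance `ε(δ) = min 1 (δ/(K_𝔰 + K_m + 1))` (`ccData_tolerance_le`).
STATUS: the qualitative node `CcDataContinuous` and the sprint node
`riemannHypothesis_of_arithmeticWeilSurface : Nonempty ArithmeticWeilSurface → RiemannHypothesis` are
ALREADY CLOSED in the tree by aws-3 (`Summits/RiemannHypothesis/MotivicDoor/AWS/ForcingDown.lean`, via
`stub_pairContinuity`) and by cc-4 (`Theorems/MotivicDoor/AWS/…`); this file does NOT re-prove them — its
content is the explicit modulus (usable by the finite-level carrier design to size the approximation
tolerance).  No zeros of `ζ` are used.
-/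

noncomputable section

open Complex Set MeasureTheory Filter Literature.NumberTheory.LFunctions
open Literature.NumberTheory.ConnesConsani2019
open Summit.RiemannHypothesis.RiemannHypothesis.Theorems.MotivicDoor.ConnesConsani
open scoped BigOperators Real ArithmeticFunction.vonMangoldt

namespace Summit.RiemannHypothesis.RiemannHypothesis.Theorems.MotivicDoor.AWS


/-! ## Continuity of `Re Q` in the `C¹`-window topology -/

/-- The support of the complexification is contained in the support. -/
private theorem tsupport_ofReal_le (u : ℝ → ℝ) : tsupport (fun t ↦ (u t : ℂ)) ⊆ tsupport u :=
  closure_mono fun x hx ↦ by simpa [Function.mem_support] using hx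

/-- Bounds transfer from `u` to an `ε`-close `v` (`ε ≤ 1`). -/
theorem abs_le_add_one_of_close {u v : ℝ → ℝ} {S ε : ℝ} (hbd : ∀ x, |u x| ≤ S) (hε1 : ε ≤ 1)
    (hclose : ∀ t, |u t - v t| ≤ ε) (x : ℝ) : |v x| ≤ S + 1 := by
  have h1 := hbd x; have h2 := hclose x
  have h3 : |v x| ≤ |u x| + |u x - v x| := by
    have := abs_sub_abs_le_abs_sub (v x) (u x)
    rw [abs_sub_comm] at this
    linarith
  linarith

/-- A difference of window-supported functions is window-supported. -/
theorem tsupport_sub_subset_window {u v : ℝ → ℝ} {R : ℝ} (hsuppu : tsupport u ⊆ Icc (-R) R)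
    (hsuppv : tsupport v ⊆ Icc (-R) R) : tsupport (fun x ↦ u x - v x) ⊆ Icc (-R) R :=
  (tsupport_sub u v).trans (union_subset hsuppu hsuppv) |>.trans' (by intro x hx; simpa using hx)

/-- The derivative of a difference of real test functions. -/
theorem deriv_sub_of_isWeilTest {u v : ℝ → ℝ} (hu : IsWeilTest fun t ↦ (u t : ℂ))
    (hv : IsWeilTest fun t ↦ (v t : ℂ)) (x : ℝ) :
    deriv (fun t ↦ u t - v t) x = deriv u x - deriv v x := by
  have hdu : DifferentiableAt ℝ u x := (contDiff_of_isWeilTest hu).differentiable (by simp) x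
  have hdv : DifferentiableAt ℝ v x := (contDiff_of_isWeilTest hv).differentiable (by simp) x
  exact (hdu.hasDerivAt.sub hdv.hasDerivAt).deriv

/-- **`ε`-continuity of `‖·‖₂²`**. -/
theorem abs_integral_norm_sq_sub_le_eps {u v : ℝ → ℝ} (hu : IsWeilTest fun t ↦ (u t : ℂ))
    (hv : IsWeilTest fun t ↦ (v t : ℂ)) {R S ε : ℝ} (hR : 0 ≤ R) (hsuppu : tsupport u ⊆ Icc (-R) R)
    (hsuppv : tsupport v ⊆ Icc (-R) R) (hbd : ∀ x, |u x| ≤ S) (hε : 0 < ε)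
    (hε1 : ε ≤ 1) (hclose : ∀ t, |u t - v t| ≤ ε) :
    |(∫ x, ‖(u x : ℂ)‖ ^ 2) - ∫ x, ‖(v x : ℂ)‖ ^ 2| ≤ ε * (2 * R + R * (S ^ 2 + (S + 1) ^ 2)) := by
  have h := abs_integral_norm_sq_sub_le hu hv hε
  have hbdv := abs_le_add_one_of_close hbd hε1 hclose
  have hw := integral_norm_sq_le_of_abs_le (w := fun x ↦ u x - v x) hR
    (tsupport_sub_subset_window hsuppu hsuppv) hclose
  have hnu := integral_norm_sq_le_of_abs_le hR hsuppu hbd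
  have hnv := integral_norm_sq_le_of_abs_le hR hsuppv hbdv
  have h1 : (∫ x, ‖((u x - v x : ℝ) : ℂ)‖ ^ 2) / ε ≤ ε * (2 * R) := by
    rw [div_le_iff₀ hε]
    calc (∫ x, ‖((u x - v x : ℝ) : ℂ)‖ ^ 2) ≤ ε ^ 2 * (2 * R) := hw
      _ = ε * (2 * R) * ε := by ring
  have h2 : ε / 2 * ((∫ x, ‖(u x : ℂ)‖ ^ 2) + ∫ x, ‖(v x : ℂ)‖ ^ 2) ≤
      ε / 2 * (S ^ 2 * (2 * R) + (S + 1) ^ 2 * (2 * R)) := by gcongr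
  calc _ ≤ _ := h
    _ ≤ ε * (2 * R) + ε / 2 * (S ^ 2 * (2 * R) + (S + 1) ^ 2 * (2 * R)) := add_le_add h1 h2
    _ = ε * (2 * R + R * (S ^ 2 + (S + 1) ^ 2)) := by ring

/-- **`ε`-continuity of the Dirichlet energy**. -/
theorem abs_weilDirichletEnergy_sub_le_eps {u v : ℝ → ℝ} (hu : IsWeilTest fun t ↦ (u t : ℂ))
    (hv : IsWeilTest fun t ↦ (v t : ℂ)) {R S S' ε : ℝ} (hR : 0 < R)
    (hsuppu : tsupport u ⊆ Icc (-R) R) (hsuppv : tsupport v ⊆ Icc (-R) R)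
    (hbd : ∀ x, |u x| ≤ S) (hder : ∀ x, |deriv u x| ≤ S') (hε : 0 < ε)
    (hε1 : ε ≤ 1) (hclose : ∀ t, |u t - v t| ≤ ε) (hclose' : ∀ t, |deriv u t - deriv v t| ≤ ε) :
    |weilDirichletEnergy R (fun t ↦ (u t : ℂ)) - weilDirichletEnergy R (fun t ↦ (v t : ℂ))| ≤
      ε * (8 * R * ((∑ n ∈ weilPrimeIndex R, (Λ n : ℝ) / Real.sqrt n) +
          ∫ t in Ioi (1 : ℝ), weilArchDensity t) * (1 + (S ^ 2 + (S + 1) ^ 2) / 2) +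
        (2 * R + 2) * (1 + (S' ^ 2 + (S' + 1) ^ 2) / 2)) := by
  set A : ℝ := (∑ n ∈ weilPrimeIndex R, (Λ n : ℝ) / Real.sqrt n) +
    ∫ t in Ioi (1 : ℝ), weilArchDensity t with hAdef
  have hA : 0 ≤ A := add_nonneg (Finset.sum_nonneg fun n _ ↦ (div_nonneg ArithmeticFunction.vonMangoldt_nonneg (Real.sqrt_nonneg _)))
    (setIntegral_nonneg measurableSet_Ioi fun t ht ↦ (weilArchDensity_pos (lt_trans one_pos ht)).le)
  have hw := isWeilTest_sub_ofReal hu hv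
  have hbdv := abs_le_add_one_of_close hbd hε1 hclose
  have hderw : ∀ x, |deriv (fun t ↦ u t - v t) x| ≤ ε := by
    intro x; rw [deriv_sub_of_isWeilTest hu hv]; exact hclose' x
  have hderv : ∀ x, |deriv v x| ≤ S' + 1 := by
    intro x
    have h1 := hder x; have h2 := hclose' x
    have h3 : |deriv v x| ≤ |deriv u x| + |deriv u x - deriv v x| := by
      have := abs_sub_abs_le_abs_sub (deriv v x) (deriv u x)
      rw [abs_sub_comm] at this
      linarith
    linarith
  have h := abs_weilDirichletEnergy_sub_le hu hv R hε
  have hEw := weilDirichletEnergy_le_of_bounds hw hR (tsupport_sub_subset_window hsuppu hsuppv)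
    hclose hderw
  have hEu := weilDirichletEnergy_le_of_bounds hu hR hsuppu hbd hder
  have hEv := weilDirichletEnergy_le_of_bounds hv hR hsuppv hbdv hderv
  rw [← hAdef] at hEw hEu hEv
  have h1 : weilDirichletEnergy R (fun t ↦ ((u t - v t : ℝ) : ℂ)) / ε ≤
      ε * (8 * R * A + (2 * R + 2)) := by
    rw [div_le_iff₀ hε]
    calc weilDirichletEnergy R (fun t ↦ ((u t - v t : ℝ) : ℂ))
        ≤ 8 * R * ε ^ 2 * A + (2 * R + 2) * ε ^ 2 := hEw
      _ = ε * (8 * R * A + (2 * R + 2)) * ε := by ring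
  have h2 : ε / 2 * (weilDirichletEnergy R (fun t ↦ (u t : ℂ)) +
      weilDirichletEnergy R (fun t ↦ (v t : ℂ))) ≤
      ε / 2 * ((8 * R * S ^ 2 * A + (2 * R + 2) * S' ^ 2) +
        (8 * R * (S + 1) ^ 2 * A + (2 * R + 2) * (S' + 1) ^ 2)) :=
    mul_le_mul_of_nonneg_left (add_le_add hEu hEv) (by positivity)
  calc _ ≤ _ := h
    _ ≤ ε * (8 * R * A + (2 * R + 2)) + ε / 2 * ((8 * R * S ^ 2 * A + (2 * R + 2) * S' ^ 2) +
        (8 * R * (S + 1) ^ 2 * A + (2 * R + 2) * (S' + 1) ^ 2)) := add_le_add h1 h2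
    _ = ε * (8 * R * A * (1 + (S ^ 2 + (S + 1) ^ 2) / 2) +
        (2 * R + 2) * (1 + (S' ^ 2 + (S' + 1) ^ 2) / 2)) := by ring

/-- **`ε`-continuity of `Re Q` in the `C¹`-window topology** (Markov form + L1 + L2 + L5). -/
theorem abs_re_weilQuadratic_sub_le_eps {u v : ℝ → ℝ} (hu : IsWeilTest fun t ↦ (u t : ℂ))
    (hv : IsWeilTest fun t ↦ (v t : ℂ)) {R S S' ε : ℝ} (hR : 0 < R)
    (hsuppu : tsupport u ⊆ Icc (-R) R) (hsuppv : tsupport v ⊆ Icc (-R) R) (hS : 0 ≤ S)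
    (hbd : ∀ x, |u x| ≤ S) (hder : ∀ x, |deriv u x| ≤ S') (hε : 0 < ε)
    (hε1 : ε ≤ 1) (hclose : ∀ t, |u t - v t| ≤ ε) (hclose' : ∀ t, |deriv u t - deriv v t| ≤ ε) :
    |(weilQuadratic fun t ↦ (u t : ℂ)).re - (weilQuadratic fun t ↦ (v t : ℂ)).re| ≤
      ε * (4 * (Real.cosh (R / 2) * (2 * R)) ^ 2 * (2 * S + 1) +
        (8 * R * ((∑ n ∈ weilPrimeIndex R, (Λ n : ℝ) / Real.sqrt n) +
            ∫ t in Ioi (1 : ℝ), weilArchDensity t) * (1 + (S ^ 2 + (S + 1) ^ 2) / 2) +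
          (2 * R + 2) * (1 + (S' ^ 2 + (S' + 1) ^ 2) / 2)) +
        |weilMarkovConstant R| * (2 * R + R * (S ^ 2 + (S + 1) ^ 2))) := by
  have hQu := weilQuadratic_re_eq_weilPoleForm_add_weilDirichletEnergy_sub hu
    ((tsupport_ofReal_le u).trans hsuppu)
  have hQv := weilQuadratic_re_eq_weilPoleForm_add_weilDirichletEnergy_sub hv
    ((tsupport_ofReal_le v).trans hsuppv)
  have hP := abs_weilPoleForm_sub_le hu hv hR.le hsuppu hsuppv hS hbd hε.le hε1 hclose
  have hN := abs_integral_norm_sq_sub_le_eps hu hv hR.le hsuppu hsuppv hbd hε hε1 hclose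
  have hE := abs_weilDirichletEnergy_sub_le_eps hu hv hR hsuppu hsuppv hbd hder hε hε1 hclose
    hclose'
  rw [hQu, hQv]
  set Pu := weilPoleForm (fun t ↦ (u t : ℂ))
  set Pv := weilPoleForm (fun t ↦ (v t : ℂ))
  set Eu := weilDirichletEnergy R (fun t ↦ (u t : ℂ))
  set Ev := weilDirichletEnergy R (fun t ↦ (v t : ℂ))
  set Nu := ∫ x, ‖(u x : ℂ)‖ ^ 2
  set Nv := ∫ x, ‖(v x : ℂ)‖ ^ 2
  set M := weilMarkovConstant R
  have hsplit : (Pu + Eu - M * Nu) - (Pv + Ev - M * Nv) = (Pu - Pv) + (Eu - Ev) - M * (Nu - Nv) := by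
    ring
  rw [hsplit]
  have hM : |M * (Nu - Nv)| ≤ |M| * (ε * (2 * R + R * (S ^ 2 + (S + 1) ^ 2))) := by
    rw [abs_mul]; exact mul_le_mul_of_nonneg_left hN (abs_nonneg _)
  calc |(Pu - Pv) + (Eu - Ev) - M * (Nu - Nv)|
      ≤ |Pu - Pv| + |Eu - Ev| + |M * (Nu - Nv)| := by
        have := abs_add_le (Pu - Pv) (Eu - Ev)
        have := abs_sub ((Pu - Pv) + (Eu - Ev)) (M * (Nu - Nv))
        linarith
    _ ≤ _ := by
        have := add_le_add (add_le_add hP hE) hM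
        refine this.trans (le_of_eq ?_)
        ring

/-! ## Assembly: the quantitative `CcDataContinuousOn` -/

/-- **`ε`-continuity of `𝔰`** via `2𝔰(f,f) = 2 d⋆(f) d_u(f) − Re Q(u)`. -/
theorem abs_ccPairing_sub_le_of_bounds {u v : ℝ → ℝ} (hu : IsWeilTest fun t ↦ (u t : ℂ))
    (hv : IsWeilTest fun t ↦ (v t : ℂ)) {KQ Km S ε : ℝ} (hKm : 0 ≤ Km) (hS : 0 ≤ S) (hε : 0 ≤ ε)
    (hQ : |(weilQuadratic fun t ↦ (u t : ℂ)).re - (weilQuadratic fun t ↦ (v t : ℂ)).re| ≤ ε * KQ)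
    (hbu : |massDu (toMul u)| ≤ S * Km) (hav : |massDstar (toMul v)| ≤ (S + 1) * Km)
    (hds : |massDstar (toMul u) - massDstar (toMul v)| ≤ ε * Km)
    (hdu : |massDu (toMul u) - massDu (toMul v)| ≤ ε * Km) :
    |ccPairing (toMul u) (toMul u) - ccPairing (toMul v) (toMul v)| ≤
      ε * (Km ^ 2 * (2 * S + 1) + KQ / 2) := by
  have hiu := two_mul_ccPairing_sub_two_mul_masses_eq hu
  have hiv := two_mul_ccPairing_sub_two_mul_masses_eq hv
  set su := ccPairing (toMul u) (toMul u)
  set sv := ccPairing (toMul v) (toMul v)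
  set au := massDstar (toMul u); set av := massDstar (toMul v)
  set bu := massDu (toMul u); set bv := massDu (toMul v)
  set Qu := (weilQuadratic fun t ↦ (u t : ℂ)).re
  set Qv := (weilQuadratic fun t ↦ (v t : ℂ)).re
  have hid : su - sv = (au - av) * bu + av * (bu - bv) - (Qu - Qv) / 2 := by
    have h1 : su = au * bu - Qu / 2 := by linarith
    have h2 : sv = av * bv - Qv / 2 := by linarith
    rw [h1, h2]; ring
  rw [hid]
  have h1 : |(au - av) * bu| ≤ ε * Km * (S * Km) := by
    rw [abs_mul]; exact mul_le_mul hds hbu (abs_nonneg _) (by positivity)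
  have h2 : |av * (bu - bv)| ≤ (S + 1) * Km * (ε * Km) := by
    rw [abs_mul]; exact mul_le_mul hav hdu (abs_nonneg _) (by positivity)
  have h3 : |(Qu - Qv) / 2| ≤ ε * KQ / 2 := by
    rw [abs_div, abs_two]; exact div_le_div_of_nonneg_right hQ zero_le_two
  calc |(au - av) * bu + av * (bu - bv) - (Qu - Qv) / 2|
      ≤ |(au - av) * bu| + |av * (bu - bv)| + |(Qu - Qv) / 2| := by
        have := abs_add_le ((au - av) * bu) (av * (bu - bv))
        have := abs_sub ((au - av) * bu + av * (bu - bv)) ((Qu - Qv) / 2)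
        linarith
    _ ≤ ε * Km * (S * Km) + (S + 1) * Km * (ε * Km) + ε * KQ / 2 := by linarith
    _ = ε * (Km ^ 2 * (2 * S + 1) + KQ / 2) := by ring

/-- The explicit `C¹`-window Lipschitz constant of the Connes–Consani form `u ↦ 𝔰(f_u, f_u)` on the
window `[-R, R]`, for a base point with `|u| ≤ S`, `|u'| ≤ S'`:
`K_𝔰(R,S,S') = K_m² (2S+1) + K_Q/2`, `K_m = e^{R/2}·2R`, `K_Q` the constant of
`abs_re_weilQuadratic_sub_le_eps`. -/
def ccPairingModulus (R S S' : ℝ) : ℝ :=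
  (Real.exp (R / 2) * (2 * R)) ^ 2 * (2 * S + 1) +
    (4 * (Real.cosh (R / 2) * (2 * R)) ^ 2 * (2 * S + 1) +
      (8 * R * ((∑ n ∈ weilPrimeIndex R, (Λ n : ℝ) / Real.sqrt n) +
          ∫ t in Ioi (1 : ℝ), weilArchDensity t) * (1 + (S ^ 2 + (S + 1) ^ 2) / 2) +
        (2 * R + 2) * (1 + (S' ^ 2 + (S' + 1) ^ 2) / 2)) +
      |weilMarkovConstant R| * (2 * R + R * (S ^ 2 + (S + 1) ^ 2))) / 2

/-- **TEST-CLASS-DOWN, quantitative form.**  For real Weil tests `u, v` supported in `[-R, R]`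
(`R > 0`) with `|u| ≤ S`, `|u'| ≤ S'` and `|u − v|, |u' − v'| ≤ ε ≤ 1`:
`|𝔰(f_u,f_u) − 𝔰(f_v,f_v)| ≤ ε · K_𝔰(R,S,S')`, `|d⋆(f_u) − d⋆(f_v)| ≤ ε · e^{R/2}·2R`,
`|d_u(f_u) − d_u(f_v)| ≤ ε · e^{R/2}·2R` — an explicit Lipschitz modulus (the qualitative
`CcDataContinuousOn R` is `ccDataContinuousOn_of_pos` of `MotivicDoor/AWS/ForcingDown.lean`). -/
theorem ccData_lipschitz {R : ℝ} (hR : 0 < R) {u v : ℝ → ℝ} (hu : IsWeilTest fun t ↦ (u t : ℂ))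
    (hv : IsWeilTest fun t ↦ (v t : ℂ)) (hsuppu : tsupport u ⊆ Icc (-R) R)
    (hsuppv : tsupport v ⊆ Icc (-R) R) {S S' ε : ℝ} (hS : 0 ≤ S) (hbd : ∀ x, |u x| ≤ S)
    (hder : ∀ x, |deriv u x| ≤ S') (hε : 0 < ε) (hε1 : ε ≤ 1) (hclose : ∀ t, |u t - v t| ≤ ε)
    (hclose' : ∀ t, |deriv u t - deriv v t| ≤ ε) :
    |ccPairing (toMul u) (toMul u) - ccPairing (toMul v) (toMul v)| ≤ ε * ccPairingModulus R S S' ∧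
      |massDstar (toMul u) - massDstar (toMul v)| ≤ ε * (Real.exp (R / 2) * (2 * R)) ∧
      |massDu (toMul u) - massDu (toMul v)| ≤ ε * (Real.exp (R / 2) * (2 * R)) := by
  set Km : ℝ := Real.exp (R / 2) * (2 * R) with hKmdef
  have hKm : 0 ≤ Km := by positivity
  set A : ℝ := (∑ n ∈ weilPrimeIndex R, (Λ n : ℝ) / Real.sqrt n) +
    ∫ t in Ioi (1 : ℝ), weilArchDensity t with hAdef
  set KQ : ℝ := 4 * (Real.cosh (R / 2) * (2 * R)) ^ 2 * (2 * S + 1) +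
    (8 * R * A * (1 + (S ^ 2 + (S + 1) ^ 2) / 2) + (2 * R + 2) * (1 + (S' ^ 2 + (S' + 1) ^ 2) / 2)) +
    |weilMarkovConstant R| * (2 * R + R * (S ^ 2 + (S + 1) ^ 2)) with hKQdef
  have hmod : ccPairingModulus R S S' = Km ^ 2 * (2 * S + 1) + KQ / 2 := by
    rw [ccPairingModulus, hKQdef, hAdef, hKmdef]
  have hbdv := abs_le_add_one_of_close hbd hε1 hclose
  have hQ := abs_re_weilQuadratic_sub_le_eps hu hv hR hsuppu hsuppv hS hbd hder hε hε1 hclose hclose'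
  rw [← hAdef, ← hKQdef] at hQ
  have hds := abs_massDstar_toMul_sub_le hu hv hR.le hsuppu hsuppv hε.le hclose
  have hdu := abs_massDu_toMul_sub_le hu hv hR.le hsuppu hsuppv hε.le hclose
  have hbu := abs_massDu_toMul_le hR.le hsuppu hS hbd
  have hav := abs_massDstar_toMul_le hR.le hsuppv (by positivity) hbdv
  have hds' : |massDstar (toMul u) - massDstar (toMul v)| ≤ ε * Km := by rw [hKmdef]; linarith
  have hdu' : |massDu (toMul u) - massDu (toMul v)| ≤ ε * Km := by rw [hKmdef]; linarith
  have hbu' : |massDu (toMul u)| ≤ S * Km := by rw [hKmdef]; linarith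
  have hav' : |massDstar (toMul v)| ≤ (S + 1) * Km := by rw [hKmdef]; linarith
  have hs := abs_ccPairing_sub_le_of_bounds hu hv hKm hS hε.le hQ hbu' hav' hds' hdu'
  rw [hmod]
  exact ⟨hs, hds', hdu'⟩

/-- The sup bounds `S, S'` of a real Weil test and its derivative exist, so `ccData_lipschitz` yields the
explicit tolerance `ε(δ) = min 1 (δ / (K_𝔰 + e^{R/2}·2R + 1))` in `CcDataContinuousOn R`; recorded as the
inequality `ε(δ) · (K_𝔰 + K_m + 1) ≤ δ` it guarantees. -/
theorem ccData_tolerance_le {R S S' δ : ℝ} (hR : 0 < R) (hS : 0 ≤ S) (hδ : 0 < δ) :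
    0 < min 1 (δ / (ccPairingModulus R S S' + Real.exp (R / 2) * (2 * R) + 1)) ∧
      min 1 (δ / (ccPairingModulus R S S' + Real.exp (R / 2) * (2 * R) + 1)) *
          (ccPairingModulus R S S' + Real.exp (R / 2) * (2 * R) + 1) ≤ δ := by
  have hA : 0 ≤ (∑ n ∈ weilPrimeIndex R, (Λ n : ℝ) / Real.sqrt n) +
      ∫ t in Ioi (1 : ℝ), weilArchDensity t :=
    add_nonneg (Finset.sum_nonneg fun n _ ↦
      (div_nonneg ArithmeticFunction.vonMangoldt_nonneg (Real.sqrt_nonneg _)))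
      (setIntegral_nonneg measurableSet_Ioi fun t ht ↦ (weilArchDensity_pos (lt_trans one_pos ht)).le)
  have hK0 : 0 ≤ ccPairingModulus R S S' := by unfold ccPairingModulus; positivity
  have hK : 0 < ccPairingModulus R S S' + Real.exp (R / 2) * (2 * R) + 1 := by positivity
  refine ⟨lt_min one_pos (div_pos hδ hK), ?_⟩
  have : min 1 (δ / (ccPairingModulus R S S' + Real.exp (R / 2) * (2 * R) + 1)) ≤
      δ / (ccPairingModulus R S S' + Real.exp (R / 2) * (2 * R) + 1) := min_le_right _ _
  rwa [le_div_iff₀ hK] at this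

end Summit.RiemannHypothesis.RiemannHypothesis.Theorems.MotivicDoor.AWS
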